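import Summits.KontsevichZagierPeriods.KontsevichZagierPeriods.Theorems.RootDecompQuadraticDescentPair18ReductionP4

/-! # `RootDecompQuadraticDescentPair18ReductionP5` — part 5/7 of the mechanical ≤400-line split of `Pair18Reduction_v5_landing.lean` (sha256 0a10c70876ba8bf2…)
Source: decomp-kz lens-6 g8 `Pair18Reduction.lean` v5 (HOME/decomp-kz-lens-6/g8/, sha256 9036e907…; critic g3 CLEARED 12:08:58Z/13:14:52Z): census pair #18 reduced to strips — `pair18_iff_strips : KZ.of A18.rep − 2 • KZ.of B18.rep ∈ KZ.relations ↔ [U1] − [U2r] + [SL] − 2•[K12c] + 2•[Kh] ∈ KZ.relations` (namespace …RootDecompQuadraticDescent.Pair18); `#print axioms` pins removed for landing.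
Split by census-1 g9 `gen/splitlean.py`: scopes re-opened with their `open`/`variable`/`set_option` context; mathematics and declaration order unchanged. -/

noncomputable section
open MeasureTheory Set MvPolynomial
namespace Summit.KontsevichZagierPeriods.RootDecompQuadraticDescent.Pair18
open Literature.NumberTheory.Transcendental
open Literature.NumberTheory.Transcendental.KZ
open Literature.ModelTheory.ExponentialFields (IsSemialgebraic continuous_aeval_real)
open Summit.KontsevichZagierPeriods.RootDecompQuadraticDescent.DarkPairs (rel_reflect_rep rel_double
  update_one_apply_zero one_div_eq_mul_one_div)
/-- **Affine substitution in the plane.**  `Φ(z) = M z + v` with `M ∈ GL₂(ℚ)`: if `Φ` maps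
`r.domain` onto `r'.domain` and `f = (f' ∘ Φ)·|det M|` on `r.domain`, then `[r] − [r'] ∈ KZ.relations`.
[cite: KontsevichZagier2001, §1.2 rule 2] -/
private theorem rel_affine (r r' : KZ.IntegralRep 2) (M : Matrix (Fin 2) (Fin 2) ℚ) (v : Fin 2 → ℚ)
    (Φ : (Fin 2 → ℝ) → (Fin 2 → ℝ))
    (hΦ : ∀ z i, Φ z i = (M i 0 : ℝ) * z 0 + (M i 1 : ℝ) * z 1 + (v i : ℝ))
    (hdet : M.det ≠ 0) (himg : r'.domain = Φ '' r.domain)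
    (hint : ∀ z ∈ r.domain, r.integrand z = r'.integrand (Φ z) * |(M.det : ℝ)|) :
    KZ.of r - KZ.of r' ∈ KZ.relations := by
  let Mr : Matrix (Fin 2) (Fin 2) ℝ := fun i j => (M i j : ℝ)
  let Lr : (Fin 2 → ℝ) →ₗ[ℝ] (Fin 2 → ℝ) := Matrix.toLin' Mr
  let Φ' : (Fin 2 → ℝ) → (Fin 2 → ℝ) →L[ℝ] (Fin 2 → ℝ) := fun _ => LinearMap.toContinuousLinearMap Lr
  have hLr : ∀ z, Lr z = fun i => (M i 0 : ℝ) * z 0 + (M i 1 : ℝ) * z 1 := by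
    intro z; funext i; simp [Lr, Mr, Matrix.toLin'_apply, Matrix.mulVec, dotProduct, Fin.sum_univ_two]
  have hΦL : Φ = fun z => Lr z + fun i => (v i : ℝ) := by
    funext z; funext i; rw [hΦ, Pi.add_apply, hLr]
  have hdetR : Mr.det = (M.det : ℝ) := by
    rw [Matrix.det_fin_two, Matrix.det_fin_two]; push_cast; simp [Mr]
  have hdet' : ∀ z, (Φ' z).det = (M.det : ℝ) := by
    intro z; rw [← hdetR]; unfold ContinuousLinearMap.det; simp [Φ', Lr, LinearMap.det_toLin']
  have hdetR' : ((M 0 0 * M 1 1 - M 0 1 * M 1 0 : ℚ) : ℝ) ≠ 0 := by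
    rw [← Matrix.det_fin_two]; exact_mod_cast hdet
  refine KZ.changeOfVariablesRel_subset_relations ⟨2, r, r', Φ, Φ', ?_, ?_, ?_, himg, ?_, rfl⟩
  · refine (isSemialgebraicMapOn_iff_forall_holds r.isSemialgebraic_domain).mpr fun i => ?_
    exact (isSemialgebraicFunOn_aeval r.isSemialgebraic_domain
      (C (M i 0) * X 0 + C (M i 1) * X 1 + C (v i))).congr fun z _ => by
        simp only [map_add, map_mul, aeval_C, aeval_X, eq_ratCast, hΦ]
  · intro z _
    rw [hΦL]; have h := ((LinearMap.toContinuousLinearMap Lr).hasFDerivAt (x := z)).add_const (fun i => (v i : ℝ))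
    simpa [Φ'] using h.hasFDerivWithinAt
  · intro z₁ _ z₂ _ h
    have e1 := congrFun h 0; have e2 := congrFun h 1; simp only [hΦ] at e1 e2
    have hx : ((M 0 0 * M 1 1 - M 0 1 * M 1 0 : ℚ) : ℝ) * (z₁ 0 - z₂ 0) = 0 := by
      push_cast; linear_combination (M 1 1 : ℝ) * e1 - (M 0 1 : ℝ) * e2
    have hy : ((M 0 0 * M 1 1 - M 0 1 * M 1 0 : ℚ) : ℝ) * (z₁ 1 - z₂ 1) = 0 := by
      push_cast; linear_combination (M 0 0 : ℝ) * e2 - (M 1 0 : ℝ) * e1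
    rcases mul_eq_zero.1 hx with h1 | h1
    · exact absurd h1 hdetR'
    rcases mul_eq_zero.1 hy with h2 | h2
    · exact absurd h2 hdetR'
    funext i; fin_cases i
    · exact sub_eq_zero.1 h1
    · exact sub_eq_zero.1 h2
  · intro z hz
    rw [hint z hz, hdet' z]

/-- Auxiliary step `abs_aeval_one_le` (§5): abs aeval one le. [bookkeeping] -/
private theorem abs_aeval_one_le (z : Fin 2 → ℝ) : |aeval z (1 : MvPolynomial (Fin 2) ℚ)| ≤ 1 := by simp

/-- (d4) `Bot ≡ H(−1)` by `(x, y) ↦ (x − y, 1 − x − y)`. -/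
theorem d4 : KZ.of Bot - KZ.of (H (-1) (by norm_num)) ∈ KZ.relations := by
  refine rel_affine Bot (H (-1) (by norm_num)) !![1, -1; -1, -1] ![0, 1]
    (fun z => ![z 0 - z 1, 1 - z 0 - z 1]) (fun z i => by fin_cases i <;> simp <;> ring)
    (by rw [Matrix.det_fin_two_of]; norm_num) ?_ fun z hz => ?_
  · ext w
    rw [mem_H_domain]
    simp only [mem_image, Bot, loP_domain, mem_sbDom, zeroE_f, mnE_f, le_min_iff]
    constructor
    · rintro ⟨⟨h0, h0'⟩, h1, h2⟩
      refine ⟨![(w 0 - w 1 + 1) / 2, (1 - w 0 - w 1) / 2], ?_, ?_⟩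
      · simp only [Matrix.cons_val_zero, Matrix.cons_val_one]
        refine ⟨⟨?_, ?_⟩, ?_, ?_, ?_⟩ <;> linarith
      · funext i; fin_cases i <;> simp <;> ring
    · rintro ⟨z, ⟨⟨h0, h0'⟩, h1, h2, h3⟩, rfl⟩
      simp only [Matrix.cons_val_zero, Matrix.cons_val_one]
      refine ⟨⟨?_, ?_⟩, ?_, ?_⟩ <;> linarith
  · have hz' := hz
    simp only [Bot, loP_domain, mem_sbDom, zeroE_f, mnE_f, le_min_iff] at hz'
    have hA := A18_den_pos (z := z) (by
      rw [cube_eq_sbDom, mem_sbDom, zeroE_f, oneE_f]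
      exact ⟨hz'.1, hz'.2.1, by linarith [hz'.2.2.2, hz'.1.1]⟩)
    have habs : |((!![1, -1; -1, -1] : Matrix (Fin 2) (Fin 2) ℚ).det : ℝ)| = 2 := by
      rw [Matrix.det_fin_two_of]; norm_num
    rw [habs, Bot, loP_integrand, A18_integrand, H_integrand]
    simp only [Matrix.cons_val_zero, Matrix.cons_val_one]
    exact inv_eq_inv_mul_two hA (by push_cast; ring)

/-- (d5) `Top ≡ H(−1)` by `(x, y) ↦ (y − x, x + y − 1)`. -/
theorem d5 : KZ.of Top - KZ.of (H (-1) (by norm_num)) ∈ KZ.relations := by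
  refine rel_affine Top (H (-1) (by norm_num)) !![-1, 1; 1, 1] ![0, -1]
    (fun z => ![z 1 - z 0, z 0 + z 1 - 1]) (fun z i => by fin_cases i <;> simp <;> ring)
    (by rw [Matrix.det_fin_two_of]; norm_num) ?_ fun z hz => ?_
  · ext w
    rw [mem_H_domain]
    simp only [mem_image, Top, Rest, hiP_domain, mem_sbDom, oneE_f, mxE_f, max_le_iff]
    constructor
    · rintro ⟨⟨h0, h0'⟩, h1, h2⟩
      refine ⟨![(w 1 - w 0 + 1) / 2, (w 0 + w 1 + 1) / 2], ?_, ?_⟩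
      · simp only [Matrix.cons_val_zero, Matrix.cons_val_one]
        refine ⟨⟨?_, ?_⟩, ⟨?_, ?_⟩, ?_⟩ <;> linarith
      · funext i; fin_cases i <;> simp <;> ring
    · rintro ⟨z, ⟨⟨h0, h0'⟩, ⟨h1, h2⟩, h3⟩, rfl⟩
      simp only [Matrix.cons_val_zero, Matrix.cons_val_one]
      refine ⟨⟨?_, ?_⟩, ?_, ?_⟩ <;> linarith
  · have hz' := hz
    simp only [Top, Rest, hiP_domain, mem_sbDom, oneE_f, mxE_f, max_le_iff] at hz'
    have hA := A18_den_pos (z := z) (by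
      rw [cube_eq_sbDom, mem_sbDom, zeroE_f, oneE_f]
      exact ⟨hz'.1, by linarith [hz'.2.1.1, hz'.1.1], hz'.2.2⟩)
    have habs : |((!![-1, 1; 1, 1] : Matrix (Fin 2) (Fin 2) ℚ).det : ℝ)| = 2 := by
      rw [Matrix.det_fin_two_of]; norm_num
    rw [habs, Top, hiP_integrand, Rest, hiP_integrand, A18_integrand, H_integrand]
    simp only [Matrix.cons_val_zero, Matrix.cons_val_one]
    exact inv_eq_inv_mul_two hA (by push_cast; ring)

/-- (d6) `MidL ≡ H(1)` by `(x, y) ↦ (y − x, 1 − x − y)`. -/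
theorem d6 : KZ.of MidL - KZ.of (H 1 (by norm_num)) ∈ KZ.relations := by
  refine rel_affine MidL (H 1 (by norm_num)) !![-1, 1; -1, -1] ![0, 1]
    (fun z => ![z 1 - z 0, 1 - z 0 - z 1]) (fun z i => by fin_cases i <;> simp <;> ring)
    (by rw [Matrix.det_fin_two_of]; norm_num) ?_ fun z hz => ?_
  · ext w
    rw [mem_H_domain]
    simp only [mem_image, MidL, GB_domain, mem_gband, mnE_f, mxE_f, Rat.cast_zero, Rat.cast_one,
      Rat.cast_div, Rat.cast_ofNat]
    constructor
    · rintro ⟨⟨h0, h0'⟩, h1, h2⟩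
      refine ⟨![(1 - w 0 - w 1) / 2, (w 0 - w 1 + 1) / 2], ?_, ?_⟩
      · simp only [Matrix.cons_val_zero, Matrix.cons_val_one]
        exact ⟨⟨by linarith, by linarith⟩, min_le_of_left_le (by linarith),
          le_max_of_le_right (by linarith)⟩
      · funext i; fin_cases i <;> simp <;> ring
    · rintro ⟨z, ⟨⟨h0, h0'⟩, h1, h2⟩, rfl⟩
      have hx : z 0 ≤ 1 - z 0 := by linarith
      rw [min_eq_left hx] at h1
      rw [max_eq_right hx] at h2
      simp only [Matrix.cons_val_zero, Matrix.cons_val_one]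
      refine ⟨⟨?_, ?_⟩, ?_, ?_⟩ <;> linarith
  · have hz' := hz
    simp only [MidL, GB_domain, mem_gband, mnE_f, mxE_f, Rat.cast_zero, Rat.cast_one, Rat.cast_div,
      Rat.cast_ofNat] at hz'
    have hx : z 0 ≤ 1 - z 0 := by linarith [hz'.1.2]
    rw [min_eq_left hx, max_eq_right hx] at hz'
    have hA := A18_den_pos (z := z) (by
      rw [cube_eq_sbDom, mem_sbDom, zeroE_f, oneE_f]
      exact ⟨⟨hz'.1.1, by linarith [hz'.1.2]⟩, by linarith [hz'.2.1, hz'.1.1],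
        by linarith [hz'.2.2, hz'.1.1]⟩)
    have habs : |((!![-1, 1; -1, -1] : Matrix (Fin 2) (Fin 2) ℚ).det : ℝ)| = 2 := by
      rw [Matrix.det_fin_two_of]; norm_num
    rw [habs, MidL, GB_integrand, Mid, loP_integrand, Rest, hiP_integrand, A18_integrand, H_integrand]
    simp only [Matrix.cons_val_zero, Matrix.cons_val_one]
    exact inv_eq_inv_mul_two hA (by push_cast; ring)

/-- (d7) `MidR ≡ H(1)` by `(x, y) ↦ (x − y, x + y − 1)`. -/
theorem d7 : KZ.of MidR - KZ.of (H 1 (by norm_num)) ∈ KZ.relations := by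
  refine rel_affine MidR (H 1 (by norm_num)) !![1, -1; 1, 1] ![0, -1]
    (fun z => ![z 0 - z 1, z 0 + z 1 - 1]) (fun z i => by fin_cases i <;> simp <;> ring)
    (by rw [Matrix.det_fin_two_of]; norm_num) ?_ fun z hz => ?_
  · ext w
    rw [mem_H_domain]
    simp only [mem_image, MidR, GB_domain, mem_gband, mnE_f, mxE_f, Rat.cast_one, Rat.cast_div,
      Rat.cast_ofNat]
    constructor
    · rintro ⟨⟨h0, h0'⟩, h1, h2⟩
      refine ⟨![(w 0 + w 1 + 1) / 2, (w 1 - w 0 + 1) / 2], ?_, ?_⟩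
      · simp only [Matrix.cons_val_zero, Matrix.cons_val_one]
        exact ⟨⟨by linarith, by linarith⟩, min_le_of_right_le (by linarith),
          le_max_of_le_left (by linarith)⟩
      · funext i; fin_cases i <;> simp <;> ring
    · rintro ⟨z, ⟨⟨h0, h0'⟩, h1, h2⟩, rfl⟩
      have hx : 1 - z 0 ≤ z 0 := by linarith
      rw [min_eq_right hx] at h1
      rw [max_eq_left hx] at h2
      simp only [Matrix.cons_val_zero, Matrix.cons_val_one]
      refine ⟨⟨?_, ?_⟩, ?_, ?_⟩ <;> linarith
  · have hz' := hz
    simp only [MidR, GB_domain, mem_gband, mnE_f, mxE_f, Rat.cast_one, Rat.cast_div,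
      Rat.cast_ofNat] at hz'
    have hx : 1 - z 0 ≤ z 0 := by linarith [hz'.1.1]
    rw [min_eq_right hx, max_eq_left hx] at hz'
    have hA := A18_den_pos (z := z) (by
      rw [cube_eq_sbDom, mem_sbDom, zeroE_f, oneE_f]
      exact ⟨⟨by linarith [hz'.1.1], hz'.1.2⟩, by linarith [hz'.2.1, hz'.1.2],
        by linarith [hz'.2.2, hz'.1.2]⟩)
    have habs : |((!![1, -1; 1, 1] : Matrix (Fin 2) (Fin 2) ℚ).det : ℝ)| = 2 := by
      rw [Matrix.det_fin_two_of]; norm_num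
    rw [habs, MidR, GB_integrand, Mid, loP_integrand, Rest, hiP_integrand, A18_integrand, H_integrand]
    simp only [Matrix.cons_val_zero, Matrix.cons_val_one]
    exact inv_eq_inv_mul_two hA (by push_cast; ring)

/-- The half-integrand triangle forms `TΔ'(c) = [Δ, 1/(2 + c·w·v)]` (value `½·TΔ(c/2)`). -/
def PD (c : ℚ) : MvPolynomial (Fin 2) ℚ := 2 + C c * X 0 * X 1

/-- Auxiliary step `PD_ge`: PD ge. [bookkeeping] -/
theorem PD_ge {c : ℚ} (hc : -1 ≤ c ∧ c ≤ 1) {z : Fin 2 → ℝ} (hz : z ∈ sbDom zeroE omE) :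
    (7 / 4 : ℝ) ≤ aeval z (PD c) := by
  have h := PΔ_ge hc hz
  simp only [PΔ, map_add, map_mul, map_one, aeval_C, aeval_X, eq_ratCast] at h
  simp only [PD, map_add, map_mul, map_ofNat, aeval_C, aeval_X, eq_ratCast]
  linarith

/-- Auxiliary definition `TΔ'`: TΔ'. [bookkeeping] -/
def TΔ' (c : ℚ) (hc : -1 ≤ c ∧ c ≤ 1) : KZ.IntegralRep 2 :=
  BRq zeroE omE 1 (PD c) (7 / 4) 1 (by norm_num) (fun _ hz => PD_ge hc hz) fun z _ => abs_aeval_one_le z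

/-- Auxiliary step `TΔ'_integrand`: TΔ' integrand. [bookkeeping] -/
theorem TΔ'_integrand (c : ℚ) (hc : -1 ≤ c ∧ c ≤ 1) (w : Fin 2 → ℝ) :
    (TΔ' c hc).integrand w = 1 / (2 + (c : ℝ) * w 0 * w 1) := by
  simp only [TΔ', BRq_integrand, PD, map_add, map_mul, map_ofNat, map_one, aeval_C, aeval_X, eq_ratCast]

/-- (d8) `TΔ'(c) ≡ H(c) + H(c)` (rule 1b: `1/(2 + cwv) = 1/(4 + 2cwv) + 1/(4 + 2cwv)`). -/
theorem d8 (c : ℚ) (hc : -1 ≤ c ∧ c ≤ 1) :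
    KZ.of (TΔ' c hc) - KZ.of (H c hc) - KZ.of (H c hc) ∈ KZ.relations := by
  have hdom : (H c hc).domain = (TΔ' c hc).domain := by
    rw [show (H c hc).domain = sbDom zeroE omE from rfl, show (TΔ' c hc).domain = sbDom zeroE omE from rfl]
  refine KZ.integrandAddRel_subset_relations ⟨2, TΔ' c hc, H c hc, H c hc, hdom, hdom, fun z hz => ?_, rfl⟩
  have hz' : z ∈ sbDom zeroE omE := hz
  have hQ := PΔ_ge hc hz'
  simp only [PΔ, map_add, map_mul, map_one, aeval_C, aeval_X, eq_ratCast] at hQ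
  rw [Pi.add_apply, H_integrand, TΔ'_integrand]
  have hD : (2 : ℝ) + (c : ℝ) * z 0 * z 1 ≠ 0 := by linarith
  have hD' : (4 : ℝ) + 2 * (c : ℝ) * z 0 * z 1 ≠ 0 := by linarith
  rw [← add_div, div_eq_div_iff hD hD']
  ring

/-- **A-side normal form**: `A18 ≡ TΔ'(1) + TΔ'(−1) = [Δ, 1/(2 + wv)] + [Δ, 1/(2 − wv)]`. -/
theorem a18_split : KZ.of A18.rep - KZ.of (TΔ' 1 (by norm_num)) - KZ.of (TΔ' (-1) (by norm_num)) ∈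
    KZ.relations := by
  have h := sub_mem (sub_mem (add_mem (add_mem (add_mem (add_mem (add_mem (add_mem d1 d2) d3) d4) d5)
    d6) d7) (d8 1 (by norm_num))) (d8 (-1) (by norm_num))
  convert h using 1
  abel

/-- (c-trick link) `TΔ(c/2) ≡ TΔ'(c) + TΔ'(c)` (rule 1b: `1/(1 + (c/2)wv) = 2/(2 + cwv)`). -/
theorem tΔ_half (c : ℚ) (hc : -1 ≤ c ∧ c ≤ 1) (hc2 : -1 ≤ c / 2 ∧ c / 2 ≤ 1) :
    KZ.of (TΔ (c / 2) hc2) - KZ.of (TΔ' c hc) - KZ.of (TΔ' c hc) ∈ KZ.relations := by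
  have hdom : (TΔ' c hc).domain = (TΔ (c / 2) hc2).domain := by
    rw [show (TΔ' c hc).domain = sbDom zeroE omE from rfl, show (TΔ (c / 2) hc2).domain = sbDom zeroE omE from rfl]
  refine KZ.integrandAddRel_subset_relations ⟨2, TΔ (c / 2) hc2, TΔ' c hc, TΔ' c hc, hdom, hdom,
    fun z hz => ?_, rfl⟩
  have hz' : z ∈ sbDom zeroE omE := hz
  have hQ := PΔ_ge hc hz'
  simp only [PΔ, map_add, map_mul, map_one, aeval_C, aeval_X, eq_ratCast] at hQ
  rw [Pi.add_apply, TΔ'_integrand]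
  simp only [TΔ, BRq_integrand, PΔ, map_add, map_mul, map_one, aeval_C, aeval_X, eq_ratCast]
  push_cast
  have hD : (1 : ℝ) + (c : ℝ) / 2 * z 0 * z 1 ≠ 0 := by linarith
  have hD' : (2 : ℝ) + (c : ℝ) * z 0 * z 1 ≠ 0 := by linarith
  rw [← add_div, div_eq_div_iff hD hD']
  ring

/-- **A-side, doubled, through the c-trick**: `2·A18 ≡ G(½) + G(−½)`. -/
theorem two_a18_G : 2 • KZ.of A18.rep - KZ.of (Gc (1 / 2) (by norm_num)).rep -
    KZ.of (Gc (-1 / 2) (by norm_num)).rep ∈ KZ.relations := by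
  have h2 : (2 : ℕ) • (KZ.of A18.rep - KZ.of (TΔ' 1 (by norm_num)) - KZ.of (TΔ' (-1) (by norm_num))) ∈
      KZ.relations := AddSubgroup.nsmul_mem _ a18_split 2
  have hp := tΔ_half 1 (by norm_num) (by norm_num)
  have hm := tΔ_half (-1) (by norm_num) (by norm_num)
  have gp := tΔ_G (1 / 2) (by norm_num)
  have gm := tΔ_G (-1 / 2) (by norm_num)
  have h := add_mem (add_mem (sub_mem (sub_mem h2 hp) hm) gp) gm
  convert h using 1
  simp only [smul_sub]
  abel

/-! ## §9 The B-side: one affine map `(x, y) ↦ (t, Y) = (x, x + 2y)` -/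

/-- Auxiliary definition `QB18` (§9): QB18. [bookkeeping] -/
def QB18 : MvPolynomial (Fin 2) ℚ := 2 + X 0 + 2 * X 1 + X 0 ^ 2 + 2 * X 0 * X 1

/-- Auxiliary step `QB18_pos` (§9): QB18 pos. [bookkeeping] -/
theorem QB18_pos {x : Fin 2 → ℝ} (hx : x ∈ cube 2) : 0 < aeval x QB18 := by
  have h0 := (hx 0).1; have h0' := (hx 0).2; have h1 := (hx 1).1; have h1' := (hx 1).2
  simp only [QB18, map_add, map_mul, map_pow, map_ofNat, aeval_X]
  positivity

/-- Census row #18, B-side: `B18 = [□², dx dy/(2 + x + 2y + x² + 2xy)]` (census orientation). -/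
def B18 : RFun 2 := ⟨1, QB18, fun _ hx => (QB18_pos hx).ne'⟩

/-- Auxiliary step `B18_integrand` (§9): B18 integrand. [bookkeeping] -/
theorem B18_integrand (z : Fin 2 → ℝ) : B18.rep.integrand z =
    1 / (2 + z 0 + 2 * z 1 + z 0 ^ 2 + 2 * z 0 * z 1) := by
  rw [RFun.rep_integrand]
  simp only [RFun.fn, B18, QB18, map_add, map_mul, map_pow, map_ofNat, map_one, aeval_X]

/-- Auxiliary step `hB18` (§9): h B18. [bookkeeping] -/
theorem hB18 : B18.rep.domain = sbDom zeroE oneE := by rw [RFun.rep_domain, cube_eq_sbDom]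

/-- The edge `t + 2`. -/
def tp2E : Edge := mkEdge (fun t => t + 2) (X 0 + 2) 1 (fun y _ => by simp)
  (fun y _ => by simp) (fun t ht => by linarith [ht.1]) (by fun_prop)
/-- Auxiliary step `tp2E_f` (§9): tp2 E f. [bookkeeping] -/
@[simp] theorem tp2E_f (t : ℝ) : tp2E.f t = t + 2 := rfl

/-- `S18h = [{0 ≤ t ≤ 1, t ≤ Y ≤ t + 2}, dt dY/(4 + 2(1+t)Y)]` and `S18 = [same band, 1/(2 + (1+t)Y)]`. -/
def QSh : MvPolynomial (Fin 2) ℚ := 4 + 2 * (1 + X 0) * X 1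
/-- Auxiliary definition `QS` (§9): QS. [bookkeeping] -/
def QS : MvPolynomial (Fin 2) ℚ := 2 + (1 + X 0) * X 1

/-- Auxiliary step `QSh_ge` (§9): QSh ge. [bookkeeping] -/
theorem QSh_ge {z : Fin 2 → ℝ} (hz : z ∈ sbDom idE tp2E) : (4 : ℝ) ≤ aeval z QSh := by
  rcases mem_sbDom.1 hz with ⟨⟨h0, _⟩, h1, _⟩
  rw [idE_f] at h1
  simp only [QSh, map_add, map_mul, map_ofNat, map_one, aeval_X]
  nlinarith [mul_nonneg (by linarith : (0 : ℝ) ≤ 1 + z 0) (h0.trans h1)]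

/-- Auxiliary step `QS_ge` (§9): QS ge. [bookkeeping] -/
theorem QS_ge {z : Fin 2 → ℝ} (hz : z ∈ sbDom idE tp2E) : (2 : ℝ) ≤ aeval z QS := by
  rcases mem_sbDom.1 hz with ⟨⟨h0, _⟩, h1, _⟩
  rw [idE_f] at h1
  simp only [QS, map_add, map_mul, map_ofNat, map_one, aeval_X]
  nlinarith [mul_nonneg (by linarith : (0 : ℝ) ≤ 1 + z 0) (h0.trans h1)]

/-- Auxiliary definition `S18h` (§9): S18h. [bookkeeping] -/
def S18h : KZ.IntegralRep 2 :=
  BRq idE tp2E 1 QSh 4 1 (by norm_num) (fun _ hz => QSh_ge hz) fun z _ => abs_aeval_one_le z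
/-- Auxiliary definition `S18` (§9): S18. [bookkeeping] -/
def S18 : KZ.IntegralRep 2 :=
  BRq idE tp2E 1 QS 2 1 (by norm_num) (fun _ hz => QS_ge hz) fun z _ => abs_aeval_one_le z

/-- Auxiliary step `S18h_integrand` (§9): S18h integrand. [bookkeeping] -/
theorem S18h_integrand (w : Fin 2 → ℝ) : S18h.integrand w = 1 / (4 + 2 * (1 + w 0) * w 1) := by
  simp only [S18h, BRq_integrand, QSh, map_add, map_mul, map_ofNat, map_one, aeval_X]
/-- Auxiliary step `S18_integrand` (§9): S18 integrand. [bookkeeping] -/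
theorem S18_integrand (w : Fin 2 → ℝ) : S18.integrand w = 1 / (2 + (1 + w 0) * w 1) := by
  simp only [S18, BRq_integrand, QS, map_add, map_mul, map_ofNat, map_one, aeval_X]

/-- Auxiliary step `mem_S_domain` (§9): mem S domain. [bookkeeping] -/
theorem mem_S_domain {w : Fin 2 → ℝ} :
    w ∈ sbDom idE tp2E ↔ (0 ≤ w 0 ∧ w 0 ≤ 1) ∧ w 0 ≤ w 1 ∧ w 1 ≤ w 0 + 2 := by
  rw [mem_sbDom, idE_f, tp2E_f]

/-- (b) `B18 ≡ S18h` by the affine map `(x, y) ↦ (x, x + 2y)` (`|det| = 2`). -/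
theorem b18_affine : KZ.of B18.rep - KZ.of S18h ∈ KZ.relations := by
  refine rel_affine B18.rep S18h !![1, 0; 1, 2] ![0, 0]
    (fun z => ![z 0, z 0 + 2 * z 1]) (fun z i => by fin_cases i <;> simp)
    (by rw [Matrix.det_fin_two_of]; norm_num) ?_ fun z hz => ?_
  · ext w
    rw [show S18h.domain = sbDom idE tp2E from rfl, mem_S_domain, hB18]
    simp only [mem_image, mem_sbDom, zeroE_f, oneE_f]
    constructor
    · rintro ⟨⟨h0, h0'⟩, h1, h2⟩
      refine ⟨![w 0, (w 1 - w 0) / 2], ?_, ?_⟩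
      · simp only [Matrix.cons_val_zero, Matrix.cons_val_one]
        refine ⟨⟨?_, ?_⟩, ?_, ?_⟩ <;> linarith
      · funext i
        fin_cases i
        · simp
        · simp; ring
    · rintro ⟨z, ⟨⟨h0, h0'⟩, h1, h2⟩, rfl⟩
      simp only [Matrix.cons_val_zero, Matrix.cons_val_one]
      refine ⟨⟨?_, ?_⟩, ?_, ?_⟩ <;> linarith
  · have hz' := hz
    rw [hB18, mem_sbDom, zeroE_f, oneE_f] at hz'
    have hA := QB18_pos (x := z) (by rw [cube_eq_sbDom, mem_sbDom, zeroE_f, oneE_f]; exact hz')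
    simp only [QB18, map_add, map_mul, map_pow, map_ofNat, aeval_X] at hA
    have habs : |((!![1, 0; 1, 2] : Matrix (Fin 2) (Fin 2) ℚ).det : ℝ)| = 2 := by
      rw [Matrix.det_fin_two_of]; norm_num
    rw [habs, B18_integrand, S18h_integrand]
    simp only [Matrix.cons_val_zero, Matrix.cons_val_one]
    exact inv_eq_inv_mul_two hA (by ring)

/-- `S18 ≡ S18h + S18h` (rule 1b). -/
theorem two_s18h : KZ.of S18 - KZ.of S18h - KZ.of S18h ∈ KZ.relations := by
  have hdom : S18h.domain = S18.domain := by
    rw [show S18h.domain = sbDom idE tp2E from rfl, show S18.domain = sbDom idE tp2E from rfl]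
  refine KZ.integrandAddRel_subset_relations ⟨2, S18, S18h, S18h, hdom, hdom, fun z hz => ?_, rfl⟩
  have hz' : z ∈ sbDom idE tp2E := hz
  have hQ := QS_ge hz'
  simp only [QS, map_add, map_mul, map_ofNat, map_one, aeval_X] at hQ
  rw [Pi.add_apply, S18_integrand, S18h_integrand]
  have hD : (2 : ℝ) + (1 + z 0) * z 1 ≠ 0 := by linarith
  have hD' : (4 : ℝ) + 2 * (1 + z 0) * z 1 ≠ 0 := by linarith
  rw [← add_div, div_eq_div_iff hD hD']
  ring

end Summit.KontsevichZagierPeriods.RootDecompQuadraticDescent.Pair18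
end
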